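import Summits.KontsevichZagierPeriods.KontsevichZagierPeriods.Theorems.SymplecticScissorsVolumeFormOffPlaneToricBC

/-!
# Toric assembly, part D: collecting unit boxes by coordinate permutations; values of log-boxes

Helper file for the stub `stub_toricAssembly` of the line `Sketch` (card `log-polytope-hilbert-three`)
of the crux `VolumeFormOffPlane` (stmt-KontsevichZagierPeriods-14935), route `SymplecticScissors`.

* Two words `w, w' : Fin n → Bool` with the same number of `false` letters differ by a
  permutation of the coordinates, so (permutation hypothesis = second conjunct of the registered
  stub `stub_logBoxLinear`) their unit log-boxes have the same class in `FormalRep ⧸ relations`;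
  a `ℤ`-combination of unit-box classes therefore COLLECTS as `∑_k C_k • W_k` over the number `k`
  of `false` letters (`toric_collect`).
* The value of an integrand-`1` representation on a log-box with corners in `α^ℤ β^ℤ` (value
  hypothesis = registered stub `stub_logBoxValue`) is the matching real number
  `∑_w (∏_j coef_j(w)) · (log α)^{#false(w)} · (log β)^{n − #false(w)}` (`toric_value`).
-/

noncomputable section

open MeasureTheory Set
open Literature.NumberTheory.Transcendental

namespace Summit.KontsevichZagierPeriods.SymplecticScissors.LogPolytope

-- Shorthands used in the SOURCE of this file (work/toric/ToricD.src.lean, expanded by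
-- work/toric/pp.py before checking/landing; the landed file is notation-free):
--   𝔅(n, a, b)  = the log-box;  𝔅₁(n, c) = 𝔅(n, fun _ => 1, c);  π = QuotientAddGroup.mk' KZ.relations
--   HPerm / HValue = the registered stub statements (verbatim).

/-! ## Words with the same letter count differ by a permutation -/

/-- The number of `true` letters is the complement of the number of `false` letters. [folklore] -/
theorem toric_card_filter_true {n : ℕ} (w : Fin n → Bool) :
    (Finset.univ.filter fun j => w j = true).card =
      n - (Finset.univ.filter fun j => w j = false).card := by
  have h := Finset.card_filter_add_card_filter_not (s := (Finset.univ : Finset (Fin n)))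
    (fun j => w j = false)
  have h' : (Finset.univ.filter fun j : Fin n => ¬ w j = false) =
      Finset.univ.filter fun j => w j = true := by
    ext j; simp
  rw [h', Finset.card_univ, Fintype.card_fin] at h
  omega

/-- Two words with the same number of `false` letters differ by a permutation of the
coordinates (fibrewise bijections, `Equiv.ofFiberEquiv`). [folklore] -/
theorem toric_exists_perm : ∀ {n : ℕ} (w w' : Fin n → Bool), (Finset.univ.filter fun j => w j = false).card = (Finset.univ.filter fun j => w' j = false).card → ∃ σ : Equiv.Perm (Fin n), ∀ j, w (σ j) = w' j := by
  intro n w w' h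
  classical
  have hcard : ∀ c : Bool, Fintype.card {a // w' a = c} = Fintype.card {b // w b = c} := by
    intro c
    rw [Fintype.card_subtype, Fintype.card_subtype]
    cases c
    · exact h.symm
    · rw [toric_card_filter_true, toric_card_filter_true, h]
  refine ⟨Equiv.ofFiberEquiv (f := w') (g := w) fun c => Fintype.equivOfCardEq (hcard c),
    fun j => ?_⟩
  exact Equiv.ofFiberEquiv_map (f := w') (g := w) (fun c => Fintype.equivOfCardEq (hcard c)) j

/-- **Unit log-boxes with the same letter count have the same class** (one coordinate
permutation, rule 2, `|det| = 1`). [folklore] -/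
theorem toric_unit_class_eq (hPerm : (∀ (n : ℕ) (a b : Fin n → ℝ) (σ : Equiv.Perm (Fin n)), ∀ (r r' : KZ.IntegralRep (n + 1)), r.domain = {p : Fin (n + 1) → ℝ | (∀ j : Fin n, a j < p (Fin.castSucc j) ∧ p (Fin.castSucc j) < b j) ∧ 0 < p (Fin.last n) ∧ p (Fin.last n) * ∏ j : Fin n, p (Fin.castSucc j) < 1} → r'.domain = {p : Fin (n + 1) → ℝ | (∀ j : Fin n, a (σ j) < p (Fin.castSucc j) ∧ p (Fin.castSucc j) < b (σ j)) ∧ 0 < p (Fin.last n) ∧ p (Fin.last n) * ∏ j : Fin n, p (Fin.castSucc j) < 1} → (∀ p ∈ r.domain, r.integrand p = 1) → (∀ p ∈ r'.domain, r'.integrand p = 1) → KZ.of r - KZ.of r' ∈ KZ.relations)) {n : ℕ} {α β : ℝ}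
    (U : (Fin n → Bool) → KZ.IntegralRep (n + 1))
    (hUd : ∀ w, (U w).domain = {ξ : Fin (n + 1) → ℝ | (∀ ι : Fin n, (fun _ => (1:ℝ)) ι < ξ (Fin.castSucc ι) ∧ ξ (Fin.castSucc ι) < (fun j => if w j = true then β else α) ι) ∧ 0 < ξ (Fin.last n) ∧ ξ (Fin.last n) * ∏ ι : Fin n, ξ (Fin.castSucc ι) < 1})
    (hU : ∀ w, ∀ x ∈ (U w).domain, (U w).integrand x = 1) (w w' : Fin n → Bool)
    (h : (Finset.univ.filter fun j => w j = false).card =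
      (Finset.univ.filter fun j => w' j = false).card) :
    (QuotientAddGroup.mk' KZ.relations) (KZ.of (U w)) = (QuotientAddGroup.mk' KZ.relations) (KZ.of (U w')) := by
  obtain ⟨σ, hσ⟩ := toric_exists_perm w w' h
  refine toric_mk_eq_iff.mpr (hPerm n (fun _ => (1:ℝ)) (fun j => if w j = true then β else α) σ
    (U w) (U w') (hUd w) ?_ (hU w) (hU w'))
  rw [hUd w']
  ext x
  simp only [mem_setOf_eq, hσ]

/-! ## Collecting a combination of unit classes by letter count -/

/-- Collecting a `ℤ`-combination over words by the value of a function `g` into `Fin (n + 1)`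
(here: the number of `false` letters), when the summands `V w` only depend on `g w`.
[folklore] -/
theorem toric_collect {G : Type*} [AddCommGroup G] {n : ℕ} (c : (Fin n → Bool) → ℤ)
    (V : (Fin n → Bool) → G) (W : Fin (n + 1) → G) (g : (Fin n → Bool) → Fin (n + 1))
    (hVW : ∀ w, V w = W (g w)) :
    ∑ w, c w • V w = ∑ k : Fin (n + 1), (∑ w ∈ Finset.univ.filter (fun w => g w = k), c w) • W k := by
  simp_rw [hVW]
  rw [← Finset.sum_fiberwise Finset.univ g (fun w => c w • W (g w))]
  refine Finset.sum_congr rfl fun k _ => ?_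
  rw [Finset.sum_smul]
  refine Finset.sum_congr rfl fun w hw => ?_
  rw [(Finset.mem_filter.mp hw).2]

/-- The letter-count function into `Fin (n + 1)` (as a term; no definition is introduced):
`#false(w) < n + 1`. [folklore] -/
theorem toric_count_lt {n : ℕ} (w : Fin n → Bool) :
    (Finset.univ.filter fun j => w j = false).card < n + 1 :=
  Nat.lt_succ_of_le ((Finset.card_filter_le _ _).trans (by simp))

/-! ## Values of log-boxes with corners in `α^ℤ β^ℤ` -/

/-- The monomial of a word: `∏_j (if w_j then Y else X) = X^{#false} · Y^{n − #false}`.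
[folklore] -/
theorem toric_prod_ite_pow {n : ℕ} (w : Fin n → Bool) (X Y : ℝ) :
    ∏ j, (if w j = true then Y else X) =
      X ^ (Finset.univ.filter fun j => w j = false).card *
        Y ^ (n - (Finset.univ.filter fun j => w j = false).card) := by
  rw [Finset.prod_ite, Finset.prod_const, Finset.prod_const, toric_card_filter_true, mul_comm]
  congr 2
  · congr 1; ext j; simp

/-- Expansion of a product of binomials over words:
`∏_j (p_j X + q_j Y) = ∑_w (∏_j coef_j(w)) X^{#false(w)} Y^{n − #false(w)}` with
`coef_j(w) = q_j` if `w_j` and `p_j` otherwise (integer coefficients, cast to `ℝ`). [folklore] -/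
theorem toric_prod_binomial {n : ℕ} (p q : Fin n → ℤ) (X Y : ℝ) :
    ∏ j, ((p j : ℝ) * X + (q j : ℝ) * Y) =
      ∑ w : Fin n → Bool, ((∏ j, (if w j = true then q j else p j) : ℤ) : ℝ) *
        X ^ (Finset.univ.filter fun j => w j = false).card *
        Y ^ (n - (Finset.univ.filter fun j => w j = false).card) := by
  have h1 : ∀ j, (p j : ℝ) * X + (q j : ℝ) * Y =
      ∑ b : Bool, (if b = true then (q j : ℝ) * Y else (p j : ℝ) * X) := by
    intro j; rw [Fintype.sum_bool]; simp [add_comm]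
  simp_rw [h1]
  rw [Finset.prod_univ_sum (fun _ => (Finset.univ : Finset Bool))
    (fun j b => if b = true then (q j : ℝ) * Y else (p j : ℝ) * X), Fintype.piFinset_univ]
  refine Finset.sum_congr rfl fun w _ => ?_
  have h2 : ∀ j, (if w j = true then (q j : ℝ) * Y else (p j : ℝ) * X) =
      ((if w j = true then q j else p j : ℤ) : ℝ) * (if w j = true then Y else X) := by
    intro j; cases w j <;> simp
  simp_rw [h2]
  rw [Finset.prod_mul_distrib, toric_prod_ite_pow, Int.cast_prod, mul_assoc]

/-- **Value of a log-box with corners in `α^ℤ β^ℤ`.** Under the value hypothesis (registered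
stub `stub_logBoxValue`): an integrand-`1` representation on the log-box with corners
`(α^{u_j} β^{v_j}, α^{u₁ j} β^{v₁ j})` has value
`∑_w (∏_j coef_j(w)) (log α)^{#false(w)} (log β)^{n − #false(w)}`, `coef_j(w) = v₁ j − v_j` if
`w_j`, `u₁ j − u_j` otherwise. [folklore] -/
theorem toric_value (hVal : (∀ (n : ℕ) (a b : Fin n → ℝ), (∀ j, 0 < a j) → (∀ j, a j < b j) → ∀ (r : KZ.IntegralRep (n + 1)), r.domain = {p : Fin (n + 1) → ℝ | (∀ j : Fin n, a j < p (Fin.castSucc j) ∧ p (Fin.castSucc j) < b j) ∧ 0 < p (Fin.last n) ∧ p (Fin.last n) * ∏ j : Fin n, p (Fin.castSucc j) < 1} → (∀ p ∈ r.domain, r.integrand p = 1) → r.value = ∏ j : Fin n, Real.log (b j / a j))) {n : ℕ} {α β : ℝ} (hα : 0 < α) (hβ : 0 < β)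
    (u v u₁ v₁ : Fin n → ℤ) (hlt : ∀ j, α ^ u j * β ^ v j < α ^ u₁ j * β ^ v₁ j)
    (r : KZ.IntegralRep (n + 1))
    (hrd : r.domain = {ξ : Fin (n + 1) → ℝ | (∀ ι : Fin n, (fun j => α ^ u j * β ^ v j) ι < ξ (Fin.castSucc ι) ∧ ξ (Fin.castSucc ι) < (fun j => α ^ u₁ j * β ^ v₁ j) ι) ∧ 0 < ξ (Fin.last n) ∧ ξ (Fin.last n) * ∏ ι : Fin n, ξ (Fin.castSucc ι) < 1})
    (hr : ∀ x ∈ r.domain, r.integrand x = 1) :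
    r.value = ∑ w : Fin n → Bool,
      ((∏ j, (if w j = true then (v₁ j - v j) else (u₁ j - u j)) : ℤ) : ℝ) *
        Real.log α ^ (Finset.univ.filter fun j => w j = false).card *
        Real.log β ^ (n - (Finset.univ.filter fun j => w j = false).card) := by
  have hpos : ∀ j, 0 < α ^ u j * β ^ v j := fun j => mul_pos (zpow_pos hα _) (zpow_pos hβ _)
  rw [hVal n (fun j => α ^ u j * β ^ v j) (fun j => α ^ u₁ j * β ^ v₁ j) hpos hlt r hrd hr,
    ← toric_prod_binomial]
  refine Finset.prod_congr rfl fun j _ => ?_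
  have hα' : α ^ u₁ j ≠ 0 := (zpow_pos hα _).ne'
  have hβ' : β ^ v₁ j ≠ 0 := (zpow_pos hβ _).ne'
  have hαu : α ^ u j ≠ 0 := (zpow_pos hα _).ne'
  have hβv : β ^ v j ≠ 0 := (zpow_pos hβ _).ne'
  rw [Real.log_div (mul_ne_zero hα' hβ') (mul_ne_zero hαu hβv), Real.log_mul hα' hβ',
    Real.log_mul hαu hβv, Real.log_zpow, Real.log_zpow, Real.log_zpow, Real.log_zpow]
  push_cast
  ring

end Summit.KontsevichZagierPeriods.SymplecticScissors.LogPolytope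

end
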